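import Summits.Ventures.LatticeQCDFlow.Scoring.SpecialUnitaryLaplace
import Summits.Ventures.LatticeQCDFlow.Scoring.TorusFreeEnergyAnalytic2D
import HarnessLib

/-!
# The weak-coupling asymptotics of the free energy density of two-dimensional `SU(N)` lattice Yang–Mills for EVERY `N`: `f_N(β) + ((N²−1)/2) log β → K^{SU}_N`

HONEST FRAMING: exact (Metropolis-corrected) sampling algorithms for lattice gauge theory;
figures of merit are autocorrelation/cost numbers at stated couplings and volumes; no
continuum-physics claim.

Venture `LatticeQCDFlow` (cell pub-lqcd), sub-topic `Scoring`; FANOUT row 5 (`s0-sun-a`), GEN-20.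
NEW WORK of the cell (placement rule).  GEN-19 (27) `TorusFreeEnergyAnalytic2D`:
`freeEnergyDensity 2 ρ_{SU(N)} β = −Nβ + log Σ_{q∈ℤ} det[I_{|q+i−j|}(β)]_{N×N}` (every `N ≥ 1`, every real `β`).
GEN-20 `SpecialUnitaryLaplace`: `Σ_q det[I_{|q+i−j|}(β)] e^{−Nβ} √β^{N²−1} → M^{SU}_N/((2π)^{N−1} N!)` with `M^{SU}_N > 0`.
Hence, for EVERY `N ≥ 1` — in particular for `SU(2)` (`(N²−1)/2 = 3/2`, GEN-20 (29)'s `−½ log 4π`) and for the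
physically relevant `SU(3)` (`(N²−1)/2 = 4`):

* **`tendsto_specialUnitary_freeEnergyDensity_two_add_log`** — `f_N(β) + ((N²−1)/2) log β → log (M^{SU}_N/((2π)^{N−1} N!))`
  as `β → ∞`: THE FREE ENERGY OF 2-d `SU(N)` LATTICE YANG–MILLS IS `−(dim SU(N)/2) log β + K^{SU}_N + o(1)` AT WEAK COUPLING;
* **`specialUnitary_freeEnergyDensity_two_leadingTerm`** — the S17-SHAPED statement in `d = 2`, every `N ≥ 1`:
  `(∀ β, HasFreeEnergyDensity 2 ρ_{SU(N)} β (freeEnergyDensity 2 ρ_{SU(N)} β)) ∧ ∃ c K, f_N(β) − c log β → K`, `c = −(N²−1)/2`;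
* `specialUnitary_three_freeEnergyDensity_two_leadingTerm` — the `SU(3)` instance: `c = −4`.

NOT CLAIMED: the closed form of `K^{SU}_N` (`M^{SU}_N = √(2π)^{N−1} sf(N)/√N`, `-- TODO(general form)`); `d ≥ 3`.
No `def`, nothing cited as a fact, 0 sorry.
-/

noncomputable section

open Real MeasureTheory Filter Topology
open Literature.MathematicalPhysics.QuantumLattice (fundamentalRep HasFreeEnergyDensity freeEnergyDensity
  hasFreeEnergyDensity_freeEnergyDensity)
open Literature.Analysis.FunctionSpaces (besselI)
open Literature.RepresentationTheory.CompactGroups.WeylIntegration (OD)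

namespace Summit.Ventures.LatticeQCDFlow.Scoring

/-- **WEAK-COUPLING ASYMPTOTICS OF THE 2-d `SU(N)` FREE ENERGY, EVERY `N ≥ 1`**: as `β → ∞`,
`freeEnergyDensity 2 ρ_{SU(N)} β + ((N²−1)/2) log β → log (M^{SU}_N / ((2π)^{N−1} N!))`. -/
theorem tendsto_specialUnitary_freeEnergyDensity_two_add_log (N : ℕ) [NeZero N] :
    Tendsto (fun β : ℝ => freeEnergyDensity 2 (fundamentalRep (Fin N)) β + ((N : ℝ) ^ 2 - 1) / 2 * Real.log β)
      atTop (𝓝 (Real.log ((∫ ψ : {i : Fin N // i ≠ 0} → ℝ,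
          Real.exp (∑ b, -((if h : b = 0 then -∑ k, ψ k else ψ ⟨b, h⟩) ^ 2 / 2)) *
          ∏ p : OD (Fin N), ((if h : p.1.1 = 0 then -∑ k, ψ k else ψ ⟨p.1.1, h⟩) -
            (if h : p.1.2 = 0 then -∑ k, ψ k else ψ ⟨p.1.2, h⟩)) ^ 2) /
        ((2 * π) ^ (N - 1) * N.factorial)))) := by
  have hM := suGaussVandermonde_pos (n := Fin N) 0
  have hK : (0 : ℝ) < (2 * π) ^ (N - 1) * N.factorial := by positivity
  have h := (tendsto_tsum_det_besselI_weakCoupling N).log (div_pos hM hK).ne'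
  refine h.congr' ?_
  filter_upwards [eventually_gt_atTop (0 : ℝ)] with β hβ
  have hZ := tsum_det_besselI_fin_pos N β
  have hs : 0 < √β := Real.sqrt_pos.2 hβ
  have h1 : 1 ≤ N ^ 2 := Nat.one_le_pow 2 N (Nat.pos_of_ne_zero (NeZero.ne N))
  rw [Real.log_mul (mul_pos hZ (Real.exp_pos _)).ne' (pow_pos hs _).ne', Real.log_mul hZ.ne' (Real.exp_pos _).ne',
    Real.log_exp, Real.log_pow, Real.log_sqrt hβ.le, freeEnergyDensity_two_specialUnitary_eq, Nat.cast_sub h1]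
  push_cast
  ring

/-- **THE LEADING TERM OF THE 2-d `SU(N)` FREE ENERGY, S17-SHAPED, EVERY `N ≥ 1`**: (i) the free energy density exists
at every `β`; (ii) `∃ c K, f_N(β) − c log β → K` as `β → ∞`, with `c = −(N²−1)/2 = −dim SU(N)/2`. -/
theorem specialUnitary_freeEnergyDensity_two_leadingTerm (N : ℕ) [NeZero N] :
    (∀ β : ℝ, HasFreeEnergyDensity 2 (fundamentalRep (Fin N)) β (freeEnergyDensity 2 (fundamentalRep (Fin N)) β)) ∧
      ∃ c K : ℝ, Tendsto
        (fun β : ℝ => freeEnergyDensity 2 (fundamentalRep (Fin N)) β - c * Real.log β) atTop (𝓝 K) := by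
  refine ⟨fun β => hasFreeEnergyDensity_freeEnergyDensity _ ⟨_, hasFreeEnergyDensity_two_specialUnitary N β⟩,
    -(((N : ℝ) ^ 2 - 1) / 2), _,
    (tendsto_specialUnitary_freeEnergyDensity_two_add_log N).congr' (Eventually.of_forall fun β => ?_)⟩
  ring

/-- **`SU(3)`**: `∃ K, freeEnergyDensity 2 ρ_{SU(3)} β + 4 log β → K` — the two-dimensional `SU(3)` free energy is
`−4 log β + K + o(1)` at weak coupling (`dim SU(3)/2 = 4`). -/
theorem specialUnitary_three_freeEnergyDensity_two_leadingTerm :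
    ∃ K : ℝ, Tendsto (fun β : ℝ => freeEnergyDensity 2 (fundamentalRep (Fin 3)) β + 4 * Real.log β) atTop (𝓝 K) := by
  refine ⟨_, (tendsto_specialUnitary_freeEnergyDensity_two_add_log 3).congr' (Eventually.of_forall fun β => ?_)⟩
  norm_num

-- TODO(general form): `K^{SU}_N = log (sf(N−1) / (√N (2π)^{(N−1)/2}))` from `M^{SU}_N = √(2π)^{N−1} sf(N)/√N`.

end Summit.Ventures.LatticeQCDFlow.Scoring
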